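import Summits.AtomisticToContinuum.Crystallization.Theorems.PricedLinkCensusTruncatedCensusGapSuperstableRedistribution
import Summits.AtomisticToContinuum.Crystallization.Theorems.PricedLinkCensusTruncatedCensusGapNearPacking
import Summits.AtomisticToContinuum.Crystallization.Theorems.TruncatedCensusGap.Negative.KappaZeroHalf

/-!
# Near-site charge pricing from local near pricing (N3′ of the line `near-far-split`)

Stub `stub_nearOfLocalPricing` (N3′, reshape r2) of the line `near-far-split` for the crux
`PricedLinkCensus.TruncatedCensusGap` (item stmt-AtomisticToContinuum-14230), skeleton
`Cruxes/TruncatedCensusGap/Lines/near_far_split.lean`.  The final statement is the registered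
signature VERBATIM: the local near pricing N2′ (zero-sum transfers `F`, `|F| ≤ C`, pricing every
DEEP-near site — all sites within `ρ` are near — at `e_χ* ≤ e_i/2 + F_i`, and at `e_χ* + κ` when
charged) implies the near-site charge pricing with far allowance NEAR′
(`N e_χ* + κ #{charged ∧ i ∈ S} ≤ E + C' #(univ \ S)` for every finset `S` cut out by the near
predicate).  `V_χ(r) = min 1 (max 0 (4 - 2r)) · V_LJ(r)`, `e_i = Σ_{k ≠ i} V_χ(|y_i - y_k|)`
(`siteEnergy`), `E = ½ Σ_i e_i` (`two_mul_interactionEnergy`).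

The proof is bookkeeping; the ONLY property of the near predicate used is its separation clause
(`a ≥ 93/100`, every site within `3a` of `y i` is `a/2`-isolated):

* `crowdFree_floor_global` — with the transfer rule `t` of the landed superstability file
  (p124427: an attractive pair is charged to its more crowded end point) a `1/4`-crowd-free site
  has redistributed half site energy `≥ -17³/24` (only crowd-free partners closer than `2` are
  negative, `≥ -1/24` each, and they are `≤ 17³` by `card_ball_count_le`);
* `sum_half_siteEnergy_sub_le_interactionEnergy` — **superstability floor keeping tame sites**:
  `E ≥ Σ_{i ∈ S} e_i/2 - 205 · #(univ \ S)` whenever the sites of `S` are `1/4`-tame at radius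
  `9/4` (index form of the p124427 transfer: `Σ G = 0`, `G = 0` at tame sites, `≥ 1` at crowded
  sites, `≥ -17³/24` at crowd-free ones);
* `card_shallow_near_le` — **shallow sites are few**: if the sites of `S` are `93/200`-isolated, those
  having a site outside `S` within `ρ` number `≤ (400 · max ρ 0 / 93 + 1)³ · #(univ \ S)`
  (packing `card_le_of_separated_of_dist_le` around each site outside `S`);
* `iInf_energyPerParticle_truncLJ_nonpos` — `e_χ* ≤ 0` (one-point trial state, or the junk
  value `0`);
* `near_pricing_assembly` — the Finset assembly for abstract predicates `P` (near) and `Ch`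
  (charged): deep sites priced by N2′, shallow sites floored at `-37 - max C 0`
  (`siteEnergy_truncLJ_ge_of_patchSeparated_window`, p167720), `Σ_S F = -Σ_{univ \ S} F`;
  constant `C' = (κ + 37 + max C 0) · (400 · max ρ 0 / 93 + 1)³ + max C 0 + 205`.
-/

noncomputable section

namespace Summit.AtomisticToContinuum.Crystallization.Theorems.PricedLinkCensusTruncatedCensusGap

open scoped BigOperators Classical
open Literature.MathematicalPhysics.StatisticalMechanics Module

/-! ## The crowd-free floor of the superstability transfer -/

section Transfer

variable (t : ℝ → ℕ → ℕ → ℝ) (ht : ∀ v a b, t v a b =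
  if v < 0 then (if a < b then -v / 2 else if b < a then v / 2 else 0) else 0)
include ht

/-- **Crowd-free sites, absolute floor.** With the transfer rule `t` (an attractive pair is
charged entirely to its more crowded end point, ties split evenly) and the global `1/4`-counts
`n`, a `1/4`-crowd-free site `i` (`n i = 1`) has `e_i/2 + F_i ≥ -17³/24`: a repulsive partner
contributes `≥ 0`, an attractive crowded partner is fully discharged, and an attractive
crowd-free partner (closer than `2`, count `≤ 1`; at most `17³` of them by `card_ball_count_le`)
contributes `V/2 ≥ -1/24`. [folklore] -/
theorem crowdFree_floor_global {N : ℕ} (y : Fin N → EuclideanSpace ℝ (Fin 3)) (V : ℝ → ℝ)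
    (hV : ∀ r, V r = min 1 (max 0 (4 - 2 * r)) * lennardJones r) (n : Fin N → ℕ)
    (hn : ∀ k, n k = (Finset.univ.filter fun j => dist (y j) (y k) < 1 / 4).card) (i : Fin N)
    (hcf : ∀ k : Fin N, k ≠ i → 1 / 4 ≤ dist (y k) (y i)) :
    -(4913 / 24 : ℝ) ≤
      siteEnergy V y i / 2 + ∑ k ∈ Finset.univ.erase i, t (V (dist (y i) (y k))) (n i) (n k) := by
  have hni : n i = 1 := by
    rw [hn, cnt_eq_one_iff]
    exact hcf
  have key : ∀ k ∈ Finset.univ.erase i,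
      -(1 / 24 : ℝ) * (if dist (y k) (y i) < 2 ∧ n k ≤ 1 then (1 : ℝ) else 0) ≤
        V (dist (y i) (y k)) / 2 + t (V (dist (y i) (y k))) (n i) (n k) := fun k _ => by
    have hv : -1 / 12 ≤ V (dist (y i) (y k)) := by
      rw [hV]
      exact neg_le_truncLJ _
    have h1 : 1 ≤ n k := by
      rw [hn]
      exact one_le_cnt y k
    have h2 : V (dist (y i) (y k)) < 0 → dist (y k) (y i) < 2 := fun h =>
      not_le.mp fun h' => h.ne (by rw [hV, dist_comm, truncLJ_eq_zero h'])
    rw [ht, hni]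
    by_cases hneg : V (dist (y i) (y k)) < 0
    · rw [if_pos hneg]
      by_cases hlt : 1 < n k
      · rw [if_pos hlt]
        split_ifs <;> linarith
      · have hk1 : n k = 1 := by omega
        have hnk : ¬ n k < 1 := by omega
        rw [if_neg hlt, if_neg hnk, if_pos ⟨h2 hneg, hk1.le⟩]
        linarith
    · rw [if_neg hneg]
      split_ifs <;> linarith
  have hsum := Finset.sum_le_sum key
  rw [← Finset.mul_sum, Finset.sum_boole] at hsum
  have hS : ((((Finset.univ.erase i).filter fun k => dist (y k) (y i) < 2 ∧ n k ≤ 1).card : ℕ) : ℝ)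
      ≤ 4913 := by
    have h := card_ball_count_le y i 1 n hn
    rw [Nat.cast_one, mul_one] at h
    refine le_trans ?_ h
    exact_mod_cast Finset.card_le_card
      (Finset.filter_subset_filter _ (Finset.erase_subset i Finset.univ))
  rw [siteEnergy, Finset.sum_div, ← Finset.sum_add_distrib]
  linarith

end Transfer

/-! ## The superstability floor keeping the tame sites -/

/-- **Superstability floor keeping tame sites.** For an injective configuration `y` and a set
`S` of sites each of which is `1/4`-tame at radius `9/4` (the sites of its closed `9/4`-ball are
`1/4`-separated), `Σ_{i ∈ S} e_i/2 - 205 · #(univ \ S) ≤ E`: with the index form `G` of the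
superstability transfer, `E = Σ_i (e_i/2 + G_i)` (`Σ G = 0`), `G_i = 0` on `S`
(`global_eq_zero_of_tame`), and off `S` each summand is `≥ 1` at crowded sites
(`one_le_global`) and `≥ -17³/24 ≥ -205` at crowd-free ones (`crowdFree_floor_global`).
[folklore] -/
theorem sum_half_siteEnergy_sub_le_interactionEnergy {N : ℕ}
    (y : Fin N → EuclideanSpace ℝ (Fin 3)) (hy : Function.Injective y) (S : Finset (Fin N))
    (htame : ∀ i ∈ S, ∀ j k : Fin N, j ≠ k → dist (y j) (y i) ≤ 9 / 4 → dist (y k) (y i) ≤ 9 / 4 →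
      1 / 4 ≤ dist (y j) (y k)) :
    ∑ i ∈ S, siteEnergy (fun r => min 1 (max 0 (4 - 2 * r)) * lennardJones r) y i / 2
        - 205 * ((Finset.univ \ S).card : ℝ) ≤
      interactionEnergy (fun r => min 1 (max 0 (4 - 2 * r)) * lennardJones r) y := by
  obtain ⟨t, ht⟩ : ∃ t : ℝ → ℕ → ℕ → ℝ, ∀ v a b, t v a b =
      if v < 0 then (if a < b then -v / 2 else if b < a then v / 2 else 0) else 0 :=
    ⟨fun v a b => if v < 0 then (if a < b then -v / 2 else if b < a then v / 2 else 0) else 0,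
      fun _ _ _ => rfl⟩
  set V : ℝ → ℝ := fun r => min 1 (max 0 (4 - 2 * r)) * lennardJones r with hVdef
  have hV : ∀ r, V r = min 1 (max 0 (4 - 2 * r)) * lennardJones r := fun _ => rfl
  set n : Fin N → ℕ := fun k => (Finset.univ.filter fun j => dist (y j) (y k) < 1 / 4).card
    with hndef
  have hn : ∀ k, n k = (Finset.univ.filter fun j => dist (y j) (y k) < 1 / 4).card := fun _ => rfl
  set G : Fin N → ℝ := fun i => ∑ k ∈ Finset.univ.erase i, t (V (dist (y i) (y k))) (n i) (n k)
    with hGdef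
  have hG0 : ∑ i, G i = 0 := global_sum_eq_zero t ht y V n
  have hE : interactionEnergy V y = ∑ i, (siteEnergy V y i / 2 + G i) := by
    rw [Finset.sum_add_distrib, hG0, add_zero, ← Finset.sum_div, ← two_mul_interactionEnergy]
    ring
  have hnear : ∑ i ∈ S, (siteEnergy V y i / 2 + G i) = ∑ i ∈ S, siteEnergy V y i / 2 :=
    Finset.sum_congr rfl fun i hi => by
      have hGi : G i = 0 := global_eq_zero_of_tame t ht y V hV n hn i (htame i hi)
      rw [hGi, add_zero]
  have hfar : ∑ _i ∈ Finset.univ \ S, (-205 : ℝ) ≤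
      ∑ i ∈ Finset.univ \ S, (siteEnergy V y i / 2 + G i) :=
    Finset.sum_le_sum fun i _ => by
      by_cases hcf : ∀ k : Fin N, k ≠ i → 1 / 4 ≤ dist (y k) (y i)
      · have h : -(4913 / 24 : ℝ) ≤ siteEnergy V y i / 2 + G i :=
          crowdFree_floor_global t ht y V hV n hn i hcf
        linarith
      · have h : 1 ≤ siteEnergy V y i / 2 + G i := one_le_global t ht y hy V hV n hn i hcf
        linarith
  rw [Finset.sum_const, nsmul_eq_mul] at hfar
  rw [hE, ← Finset.sum_sdiff (Finset.subset_univ S), hnear]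
  linarith

/-! ## Shallow sites are few -/

/-- **Shallow sites are few.** If every site of `S` is at distance `≥ 93/200` from every other
site, then the sites of `S` having some site outside `S` within distance `ρ` number at most
`(400 · max ρ 0 / 93 + 1)³ · #(univ \ S)`: around each site `j ∉ S` the sites of `S` within `ρ`
are distinct `93/200`-separated points of the closed `max ρ 0`-ball about `y j`
(`card_le_of_separated_of_dist_le`). [folklore] -/
theorem card_shallow_near_le {N : ℕ} (y : Fin N → EuclideanSpace ℝ (Fin 3)) (S : Finset (Fin N))
    (ρ : ℝ) (hsep : ∀ i ∈ S, ∀ k : Fin N, k ≠ i → 93 / 200 ≤ dist (y k) (y i)) :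
    ((S.filter fun i => ¬ ∀ i' : Fin N, dist (y i') (y i) ≤ ρ → i' ∈ S).card : ℝ) ≤
      (400 * max ρ 0 / 93 + 1) ^ 3 * ((Finset.univ \ S).card : ℝ) := by
  set M : ℝ := (400 * max ρ 0 / 93 + 1) ^ 3 with hM
  set Sh := S.filter fun i => ¬ ∀ i' : Fin N, dist (y i') (y i) ≤ ρ → i' ∈ S with hSh
  set T : Fin N → Finset (Fin N) := fun j => S.filter fun i => dist (y j) (y i) ≤ ρ with hT
  have hsub : Sh ⊆ (Finset.univ \ S).biUnion T := by
    intro i hi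
    obtain ⟨hiS, hnd⟩ := Finset.mem_filter.1 hi
    push Not at hnd
    obtain ⟨j, hj, hjS⟩ := hnd
    exact Finset.mem_biUnion.2
      ⟨j, Finset.mem_sdiff.2 ⟨Finset.mem_univ _, hjS⟩, Finset.mem_filter.2 ⟨hiS, hj⟩⟩
  have hTj : ∀ j, ((T j).card : ℝ) ≤ M := fun j => by
    have hinj : Set.InjOn y (T j) := fun i hi k _ hik => by
      by_contra hne
      have h1 := hsep i (Finset.mem_filter.1 hi).1 k (fun h => hne h.symm)
      rw [hik, dist_self] at h1
      linarith
    have h := card_le_of_separated_of_dist_le ((T j).image y) (y j)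
      (by norm_num : (0 : ℝ) < 93 / 200) (le_max_right ρ 0) ?_ ?_
    · rw [finrank_euclideanSpace_fin, Finset.card_image_of_injOn hinj] at h
      have e : (2 * max ρ 0 / (93 / 200) + 1 : ℝ) = 400 * max ρ 0 / 93 + 1 := by ring
      rwa [e] at h
    · simp only [Finset.mem_image]
      rintro _ ⟨i, hi, rfl⟩
      rw [dist_comm]
      exact (Finset.mem_filter.1 hi).2.trans (le_max_left _ _)
    · simp only [Finset.mem_image]
      rintro _ ⟨i, hi, rfl⟩ _ ⟨k, _, rfl⟩ hik
      rw [dist_comm]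
      exact hsep i (Finset.mem_filter.1 hi).1 k fun h => hik (by rw [h])
  calc (Sh.card : ℝ) ≤ ((Finset.univ \ S).biUnion T).card := by
        exact_mod_cast Finset.card_le_card hsub
    _ ≤ ∑ j ∈ Finset.univ \ S, ((T j).card : ℝ) := by
        exact_mod_cast Finset.card_biUnion_le
    _ ≤ ∑ _j ∈ Finset.univ \ S, M := Finset.sum_le_sum fun j _ => hTj j
    _ = M * ((Finset.univ \ S).card : ℝ) := by rw [Finset.sum_const, nsmul_eq_mul, mul_comm]

/-! ## `e_χ* ≤ 0` -/

/-- **`e_χ* ≤ 0`.** If the periodic energies per particle of `V_χ` are bounded below, the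
one-point cluster (energy `0`) is a trial state (`iInf_energyPerParticle_le_div`, cubic
periodisation beyond the range `2`); otherwise the conditionally complete infimum is the junk
value `0`. [folklore] -/
theorem iInf_energyPerParticle_truncLJ_nonpos :
    (⨅ Q : PeriodicConfiguration 3,
      Q.energyPerParticle (fun r => min 1 (max 0 (4 - 2 * r)) * lennardJones r)) ≤ 0 := by
  by_cases hB : BddBelow (Set.range fun Q : PeriodicConfiguration 3 =>
      Q.energyPerParticle (fun r => min 1 (max 0 (4 - 2 * r)) * lennardJones r))
  · have h := Summit.AtomisticToContinuum.Crystallization.Theorems.iInf_energyPerParticle_le_div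
      (V := fun r => min 1 (max 0 (4 - 2 * r)) * lennardJones r) (R := 2)
      (fun r hr => truncLJ_eq_zero hr) hB (y := fun _ : Fin 1 => (0 : EuclideanSpace ℝ (Fin 3)))
      (fun a b _ => Subsingleton.elim a b) one_pos
    rwa [interactionEnergy_of_subsingleton, zero_div] at h
  · exact (Real.iInf_of_not_bddBelow hB).le

/-! ## The assembly -/

/-- **Assembly of N3′ (abstract near predicate `P`, abstract charge predicate `Ch`).** Let `y`
be injective, `S = {i | P i}`, every `P`-site carry a scale `a ≥ 93/100` at which every site
within `3a` of it is `a/2`-isolated, `e* ≤ 0`, `0 ≤ κ`, and let `F : Fin N → ℝ` be zero-sum with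
`|F| ≤ C` and price every deep site (`P` throughout its closed `ρ`-ball) at
`e* ≤ e_i/2 + F_i`, `e* + κ ≤ e_i/2 + F_i` if `Ch i`.  Then
`N e* + κ #{Ch ∧ i ∈ S} ≤ E + ((κ + 37 + max C 0)(400 max ρ 0 / 93 + 1)³ + max C 0 + 205) #(univ \ S)`:
superstability floor for the sites off `S` (`sum_half_siteEnergy_sub_le_interactionEnergy`;
`P`-sites are tame), `Σ_S F = -Σ_{univ \ S} F ≤ max C 0 · #(univ \ S)`, deep sites priced,
shallow sites floored at `-37 - max C 0` (`siteEnergy_truncLJ_ge_of_patchSeparated_window`) and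
counted by `card_shallow_near_le`, `#deep · e* ≥ N e*`. [folklore] -/
theorem near_pricing_assembly {N : ℕ} (y : Fin N → EuclideanSpace ℝ (Fin 3))
    (hy : Function.Injective y) (P Ch : Fin N → Prop) (S : Finset (Fin N))
    (hS : ∀ i, i ∈ S ↔ P i)
    (hP : ∀ i, P i → ∃ a : ℝ, 93 / 100 ≤ a ∧
      ∀ j k : Fin N, j ≠ k → dist (y j) (y i) ≤ 3 * a → a / 2 ≤ dist (y j) (y k))
    (estar κ C ρ : ℝ) (he : estar ≤ 0) (hκ : 0 ≤ κ) (F : Fin N → ℝ) (hF1 : ∑ i, F i = 0)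
    (hF2 : ∀ i, |F i| ≤ C)
    (hF3 : ∀ i, (∀ i' : Fin N, dist (y i') (y i) ≤ ρ → P i') →
      estar ≤ siteEnergy (fun r => min 1 (max 0 (4 - 2 * r)) * lennardJones r) y i / 2 + F i ∧
      (Ch i → estar + κ ≤
        siteEnergy (fun r => min 1 (max 0 (4 - 2 * r)) * lennardJones r) y i / 2 + F i)) :
    (N : ℝ) * estar + κ * (Nat.card {i : Fin N // Ch i ∧ i ∈ S} : ℝ) ≤
      interactionEnergy (fun r => min 1 (max 0 (4 - 2 * r)) * lennardJones r) y +
        ((κ + 37 + max C 0) * (400 * max ρ 0 / 93 + 1) ^ 3 + max C 0 + 205) *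
          ((Finset.univ \ S).card : ℝ) := by
  set V : ℝ → ℝ := fun r => min 1 (max 0 (4 - 2 * r)) * lennardJones r with hVdef
  set C₀ : ℝ := max C 0 with hC₀def
  set M : ℝ := (400 * max ρ 0 / 93 + 1) ^ 3 with hM
  have hM0 : 0 ≤ M := by positivity
  have hC₀ : C ≤ C₀ := le_max_left _ _
  have hC₀0 : 0 ≤ C₀ := le_max_right _ _
  -- the two geometric consequences of `P`
  have hsep : ∀ i ∈ S, ∀ k : Fin N, k ≠ i → 93 / 200 ≤ dist (y k) (y i) := by
    intro i hi k hki
    obtain ⟨a, ha, hs⟩ := hP i ((hS i).1 hi)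
    have h := hs i k (Ne.symm hki) (by rw [dist_self]; linarith)
    rw [dist_comm]
    linarith
  have htame : ∀ i ∈ S, ∀ j k : Fin N, j ≠ k → dist (y j) (y i) ≤ 9 / 4 →
      dist (y k) (y i) ≤ 9 / 4 → 1 / 4 ≤ dist (y j) (y k) := by
    intro i hi j k hjk hj _
    obtain ⟨a, ha, hs⟩ := hP i ((hS i).1 hi)
    have h := hs j k hjk (by linarith)
    linarith
  -- (1) superstability floor off `S`
  have h1 : ∑ i ∈ S, siteEnergy V y i / 2 - 205 * ((Finset.univ \ S).card : ℝ) ≤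
      interactionEnergy V y := sum_half_siteEnergy_sub_le_interactionEnergy y hy S htame
  -- (2) the transfers of N2′ leave `S` with at most `C₀` per site off `S`
  have h2 : ∑ i ∈ S, F i ≤ C₀ * ((Finset.univ \ S).card : ℝ) := by
    have hs := Finset.sum_sdiff (Finset.subset_univ S) (f := F)
    have hb : ∑ _i ∈ Finset.univ \ S, -C₀ ≤ ∑ i ∈ Finset.univ \ S, F i :=
      Finset.sum_le_sum fun i _ => by
        have := (abs_le.1 ((hF2 i).trans hC₀)).1
        linarith
    rw [Finset.sum_const, nsmul_eq_mul] at hb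
    linarith [hF1]
  have hSsum : ∑ i ∈ S, siteEnergy V y i / 2 =
      ∑ i ∈ S, (siteEnergy V y i / 2 + F i) - ∑ i ∈ S, F i := by
    rw [Finset.sum_add_distrib]
    ring
  -- (3) deep / shallow split of `S`
  set D := S.filter fun i => ∀ i' : Fin N, dist (y i') (y i) ≤ ρ → i' ∈ S with hD
  set Sh := S.filter fun i => ¬ ∀ i' : Fin N, dist (y i') (y i) ≤ ρ → i' ∈ S with hShdef
  have hsplit : ∑ i ∈ S, (siteEnergy V y i / 2 + F i) =
      ∑ i ∈ D, (siteEnergy V y i / 2 + F i) + ∑ i ∈ Sh, (siteEnergy V y i / 2 + F i) :=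
    (Finset.sum_filter_add_sum_filter_not S _ _).symm
  have hDsum : ∑ i ∈ D, (estar + κ * (if Ch i then (1 : ℝ) else 0)) ≤
      ∑ i ∈ D, (siteEnergy V y i / 2 + F i) :=
    Finset.sum_le_sum fun i hi => by
      obtain ⟨-, hid⟩ := Finset.mem_filter.1 hi
      have h := hF3 i fun i' hi' => (hS i').1 (hid i' hi')
      split_ifs with hc
      · have := h.2 hc
        linarith
      · have := h.1
        linarith
  have hDeval : ∑ i ∈ D, (estar + κ * (if Ch i then (1 : ℝ) else 0)) =
      (D.card : ℝ) * estar + κ * ((D.filter fun i => Ch i).card : ℝ) := by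
    rw [Finset.sum_add_distrib, Finset.sum_const, nsmul_eq_mul, ← Finset.mul_sum, Finset.sum_boole]
  have hShsum : ∑ _i ∈ Sh, (-(37 + C₀)) ≤ ∑ i ∈ Sh, (siteEnergy V y i / 2 + F i) :=
    Finset.sum_le_sum fun i hi => by
      obtain ⟨hiS, -⟩ := Finset.mem_filter.1 hi
      obtain ⟨a, ha, hs⟩ := hP i ((hS i).1 hiS)
      have hfl : -74 ≤ siteEnergy V y i := siteEnergy_truncLJ_ge_of_patchSeparated_window y i ha hs
      have hFi := (abs_le.1 ((hF2 i).trans hC₀)).1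
      linarith
  rw [Finset.sum_const, nsmul_eq_mul] at hShsum
  -- (4) counting
  have hShcard : (Sh.card : ℝ) ≤ M * ((Finset.univ \ S).card : ℝ) := card_shallow_near_le y S ρ hsep
  have hDN : (D.card : ℝ) ≤ N := by
    have h := Finset.card_le_univ D
    rw [Fintype.card_fin] at h
    exact_mod_cast h
  have hChS : (Nat.card {i : Fin N // Ch i ∧ i ∈ S} : ℝ) ≤
      ((D.filter fun i => Ch i).card : ℝ) + Sh.card := by
    rw [Nat.card_eq_fintype_card, Fintype.card_subtype]
    have hsub : (Finset.univ.filter fun i => Ch i ∧ i ∈ S) ⊆ (D.filter fun i => Ch i) ∪ Sh := by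
      intro i hi
      obtain ⟨hc, hiS⟩ := (Finset.mem_filter.1 hi).2
      by_cases hd : ∀ i' : Fin N, dist (y i') (y i) ≤ ρ → i' ∈ S
      · exact Finset.mem_union_left _
          (Finset.mem_filter.2 ⟨Finset.mem_filter.2 ⟨hiS, hd⟩, hc⟩)
      · exact Finset.mem_union_right _ (Finset.mem_filter.2 ⟨hiS, hd⟩)
    exact_mod_cast (Finset.card_le_card hsub).trans (Finset.card_union_le _ _)
  -- (5) assembly
  have hDe : (N : ℝ) * estar ≤ D.card * estar := mul_le_mul_of_nonpos_right hDN he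
  have hκSh : κ * (Nat.card {i : Fin N // Ch i ∧ i ∈ S} : ℝ) ≤
      κ * ((D.filter fun i => Ch i).card : ℝ) + κ * Sh.card := by
    nlinarith [mul_le_mul_of_nonneg_left hChS hκ]
  have hMSh : (κ + 37 + C₀) * (Sh.card : ℝ) ≤ (κ + 37 + C₀) * (M * ((Finset.univ \ S).card : ℝ)) :=
    mul_le_mul_of_nonneg_left hShcard (by linarith)
  linarith [hsplit, hDsum, hShsum, hDeval, h1, h2, hSsum, hDe, hκSh, hMSh]

/-- **N3′ `stub_nearOfLocalPricing` (registered signature, line `near-far-split`, reshape r2):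
local near pricing N2′ implies the near-site charge pricing with far allowance NEAR′.**  From
zero-sum transfers `F` bounded by `C` that price every deep-near site at `e_χ*` (at `e_χ* + κ`
when charged): for every injective `y` and every finset `S` cut out by the near predicate,
`N e_χ* + κ #{charged ∧ i ∈ S} ≤ E + C' #(univ \ S)` with the same `κ` and
`C' = (κ + 37 + max C 0)(400 max ρ 0 / 93 + 1)³ + max C 0 + 205` (`near_pricing_assembly`
with `P :=` the near predicate — only its separation clause is used — and
`Ch := ¬ IsChargeFree (1/100) y`, `e_χ* ≤ 0` by `iInf_energyPerParticle_truncLJ_nonpos`).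
[folklore] -/
theorem stub_nearOfLocalPricing :
    (∃ κ C ρ : ℝ, 0 < κ ∧ ∃ F : (N : ℕ) → (Fin N → EuclideanSpace ℝ (Fin 3)) → Fin N → ℝ, (∀ (N : ℕ) (y : Fin N → EuclideanSpace ℝ (Fin 3)), Function.Injective y → ∑ i, F N y i = 0) ∧ (∀ (N : ℕ) (y : Fin N → EuclideanSpace ℝ (Fin 3)) (i : Fin N), Function.Injective y → |F N y i| ≤ C) ∧ ∀ (N : ℕ) (y : Fin N → EuclideanSpace ℝ (Fin 3)) (i : Fin N), Function.Injective y → (∀ i' : Fin N, dist (y i') (y i) ≤ ρ → ∃ (a c : ℝ) (s : ℤ → ℤ) (g : EuclideanSpace ℝ (Fin 3) ≃ᵃⁱ[ℝ] EuclideanSpace ℝ (Fin 3)), 93 / 100 ≤ a ∧ a ≤ 51 / 50 ∧ 78 / 100 * a ≤ c ∧ c ≤ 86 / 100 * a ∧ Literature.MathematicalPhysics.StatisticalMechanics.IsHaggSeq s ∧ (∀ j k : Fin N, j ≠ k → dist (y j) (y i') ≤ 3 * a → a / 2 ≤ dist (y j) (y k)) ∧ (∀ j : Fin N, dist (y j)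 (y i') ≤ 3 * a → ∃ z ∈ Literature.MathematicalPhysics.StatisticalMechanics.barlowStacking a c s, dist (y j) (g z) ≤ a / 50) ∧ (∀ z ∈ Literature.MathematicalPhysics.StatisticalMechanics.barlowStacking a c s, dist (g z) (y i') ≤ 3 * a → ∃ j : Fin N, dist (y j) (g z) ≤ a / 50)) → (⨅ Q : Literature.MathematicalPhysics.StatisticalMechanics.PeriodicConfiguration 3, Q.energyPerParticle (fun r => min 1 (max 0 (4 - 2 * r)) * Literature.MathematicalPhysics.StatisticalMechanics.lennardJones r)) ≤ Literature.MathematicalPhysics.StatisticalMechanics.siteEnergy (fun r => min 1 (max 0 (4 - 2 * r)) * Literature.MathematicalPhysics.StatisticalMechanics.lennardJones r) y i / 2 + F N y i ∧ (¬ Literature.Geometry.DiscreteGeometry.IsChargeFree (1 / 100 : ℝ) y i → (⨅ Q : Literature.MathematicalPhysics.StatisticalMechanics.PeriodicConfiguration 3, Q.energyPerParticle (fun r => min 1 (max 0 (4 - 2 * r)) * Literature.MathematicalPhysics.StatisticalMechanics.lennardJones r)) + κ ≤ Literature.MathematicalPhysics.StatisticalMechanics.siteEnergy (fun r => min 1 (max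 0 (4 - 2 * r)) * Literature.MathematicalPhysics.StatisticalMechanics.lennardJones r) y i / 2 + F N y i)) → (∃ κ C : ℝ, 0 < κ ∧ ∀ (N : ℕ) (y : Fin N → EuclideanSpace ℝ (Fin 3)), Function.Injective y → ∀ S : Finset (Fin N), (∀ i : Fin N, i ∈ S ↔ ∃ (a c : ℝ) (s : ℤ → ℤ) (g : EuclideanSpace ℝ (Fin 3) ≃ᵃⁱ[ℝ] EuclideanSpace ℝ (Fin 3)), 93 / 100 ≤ a ∧ a ≤ 51 / 50 ∧ 78 / 100 * a ≤ c ∧ c ≤ 86 / 100 * a ∧ Literature.MathematicalPhysics.StatisticalMechanics.IsHaggSeq s ∧ (∀ j k : Fin N, j ≠ k → dist (y j) (y i) ≤ 3 * a → a / 2 ≤ dist (y j) (y k)) ∧ (∀ j : Fin N, dist (y j) (y i) ≤ 3 * a → ∃ z ∈ Literature.MathematicalPhysics.StatisticalMechanics.barlowStacking a c s, dist (y j) (g z) ≤ a / 50) ∧ (∀ z ∈ Literature.MathematicalPhysics.StatisticalMechanics.barlowStacking a c s, dist (g z) (y i) ≤ 3 * a → ∃ j : Fin N, dist (y j) (g z)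 ≤ a / 50)) → (N : ℝ) * (⨅ Q : Literature.MathematicalPhysics.StatisticalMechanics.PeriodicConfiguration 3, Q.energyPerParticle (fun r => min 1 (max 0 (4 - 2 * r)) * Literature.MathematicalPhysics.StatisticalMechanics.lennardJones r)) + κ * (Nat.card {i : Fin N // ¬ Literature.Geometry.DiscreteGeometry.IsChargeFree (1 / 100 : ℝ) y i ∧ i ∈ S} : ℝ) ≤ Literature.MathematicalPhysics.StatisticalMechanics.interactionEnergy (fun r => min 1 (max 0 (4 - 2 * r)) * Literature.MathematicalPhysics.StatisticalMechanics.lennardJones r) y + C * ((Finset.univ \ S).card : ℝ)) := by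
  rintro ⟨κ, C, ρ, hκ, F, hF1, hF2, hF3⟩
  refine ⟨κ, (κ + 37 + max C 0) * (400 * max ρ 0 / 93 + 1) ^ 3 + max C 0 + 205, hκ,
    fun N y hy S hS => ?_⟩
  exact near_pricing_assembly y hy _ _ S hS
    (fun i hi => by
      obtain ⟨a, c, s, g, ha, -, -, -, -, hs, -, -⟩ := hi
      exact ⟨a, ha, hs⟩)
    _ κ C ρ iInf_energyPerParticle_truncLJ_nonpos hκ.le (F N y) (hF1 N y hy)
    (fun i => hF2 N y i hy) (fun i hi => hF3 N y i hy hi)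

end Summit.AtomisticToContinuum.Crystallization.Theorems.PricedLinkCensusTruncatedCensusGap

end
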